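import Literature.MathematicalPhysics.QuantumFieldTheory.Balaban1983to89.B9SectBCodedClassY
import Literature.MathematicalPhysics.QuantumFieldTheory.Balaban1983to89.B9Eq359VarParBY

/-!
# `Balaban1983to89.B9SectBCodedClassGY` — THE EXTENDED CODED CLASS `C37GY := C37Y ∧ CplxLettersGY ∧ VarParBY parBY` OF THE SECT.-B CHAIN AT NODE 00:
# the seven further (3.37) letter bounds of r06's G clause DERIVED from the record's class (3.37), and the chain's class hypothesis `hclass` for it
# (pub-ymgap N06 row 13, G side: the displayed laws `hC37G` and `hvarB` of gen 13's `gFrame₅CodedOn` discharged at the record by the choice `C37 := C37GY`,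
# `parB := parBY`, `cVar := cVarGY d ℓ`)

T. Bałaban, *Propagators for lattice gauge theories in a background field*, Commun. Math. Phys. **99** (1985) 389–434
[`Balaban1985BackgroundPropagators`, "B9"]; [4] = T. Bałaban, *Propagators and renormalization transformations for lattice gauge theories. II*,
Commun. Math. Phys. **96** (1984) 223–250 [`Balaban1984PropagatorsII`].

statement-level skeleton of published theorems with citation tags; proofs where landed; nothing here is a claim about the Yang–Mills mass gap

THE PRINTED LOCUS.  (3.37) p. 396: *«U′ = e^{iηA′}, … |A′| < α₁(Lʲη)⁻¹, |∇^η_U A′| < α₁(Lʲη)⁻² on Ω_j»*; p. 397 (after (3.41)): the own-level reading (neighbouring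
blocks differ by at most one level); (3.72)–(3.75) p. 405 (the stencils `st(b)` and the dependence sets of the bracket).

WHY THIS FILE (seat dag-n06-c gen 15, unit (C) part 1).  gen 13's G frame instance `B9SectBGFrameCodedY.gFrame₅CodedOn` displays, beyond the root frame's
dictionary hypothesis `hC37 : C37 β U a → GVal U ∧ CplxLettersY … β U a`, the law `hC37G : C37 β U a → CplxLettersGY G x ιB β U a` (the seven FURTHER (3.37)
letter bounds of r06's G clause, `B9SectBGClassLettersY.CplxLettersGY`: the charted field and its covariant differences read at the stencil points of a bond,
measured at the scale of the block of the bond's base point) and the law `hvarB : C37 β U a → VarParBY x parB cVar β U a` (the bond-averaging transporter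
variation, derived at `parBY` from (3.37) by this seat's `B9Eq359VarParBY.varParBY_parBY_of_cplx337`).  g8's coded class `C37Y := GVal ∧ CplxLettersY`
(`B9SectBCodedClassY`) makes `hC37` a projection but cannot supply `hC37G`, `hvarB`.  THIS FILE extends the class: §2 ★★ `cplxLettersGY_of_cplx337` derives all seven G letters at exponent `L⁴α₁` from r06's class
`Cplx337` on the member's torus chart (g8's template `cplxLettersY_of_cplx337`: the chart transports `covD_chart`, `covDstar = −R⁻¹·covD` one step back,
unitary-like transports, and ONE FACTOR `L` PER STENCIL STEP — every stencil point lies within block-graph distance `2(d+1) < M` of the base point, so the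
blocks differ by at most one level, `B9RWSumsCompleteGeo9YNbr.len_le_of_dist_lt_M_geo9K`); §3 defines `C37GY G x ιB Cq := C37Y … ∧ CplxLettersGY … ∧ VarParBY x (parBY x) (cVarGY d ℓ) …`
(same exponent), whose projections ARE `hC37`, `hC37G` and `hvarB` (at `parB := parBY`, `cVar := cVarGY d ℓ`), and proves the chain's class hypothesis `hclass` for the codings `codingYx G (f j) (C37GY …) (C38 j)`
with g8's numbers (`r = L⁴`, `αcap = 1∕4`, `Mc = 2(d+1)+1`): ★★ `hclass_C37GY_at`, `hclass_C37GY_on`.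

HONEST SCOPE.  A dictionary between two typed readings of (3.37); ONE definition with parameters (`C37GY`, a coded class — no `… : Prop` fact asserted);
nothing of Theorem 3.1∕3.4 asserted; COUNT-NEUTRAL; N06 NOT discharged.  NOT in this file: the plaquette law `hreg335P` (not derivable at the
`bg9Y ∕ cubeClass396` premise — n06-j's uncovered bonds, `B9PlaquetteBinderOfReg335Y` header — and left displayed; the class choice is the knit's).  One finite lattice programme — nothing continuum ∕ OS ∕ mass-gap ∕ Clay.  Cell `pub-ymgap` (HUMAN RULING
D-0062), Track A node N06 [B9], N06-ASSIGNMENT row 13, 2026-08-29; `--supports stmt-QuantumFields-27364`.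

RELATED IN THE TREE, NOT DUPLICATED (used by name): `B9SectBCodedClassY` (`C37Y`, `cplxLettersY_of_cplx337`, `hclass_C37Y_at`, the chart transports
`covD_chart ∕ norm_R_le_of_unitaryLike ∕ len_blkC_eq_scaleLen ∕ len_blkC_le_mul_symm_shift`), `B9SectBGClassLettersY` (`CplxLettersGY`, the stencils
`stencilF_blkC' ∕ stencilB_blkC' ∕ stencilFB_blkC ∕ stencilSt_blkC ∕ stencilThrough_blkC ∕ stencil0_blkC`), `B9RWSumsCompleteGeo9YNbr.len_le_of_dist_lt_M_geo9K`,
`B9Eq371Composition.covDstar_eq_neg_R_covD`, `B9Eq359VarParBY` (`cVarGY`, `varParBY_parBY_of_cplx337`, `varParBY_mono`), `B9SectBCodedChainC37Y.hclass_C37Y_on`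
(the `C37Y` twin of §4).
-/

noncomputable section

namespace Literature.MathematicalPhysics.QuantumFieldTheory.Balaban1983to89.B9SectBCodedClassGY

open Complex
open T4RelativeLadder (UnitaryLike)
open B6GlobalChartV1 (PV boxEquiv)
open B6KLevelCensusIndexV1 (KIdx kGeo)
open B6Ineq2142KLevelV1 (β)
open B9BackgroundsKLevelV1 (shiftsV1 levV1)
open B9Eq39Adjoint (R covD covDstar fluct R_neg R_smul)
open B9Eq352DivForm (tauF tauB)
open B9Eq371Composition (covDstar_eq_neg_R_covD)
open B9Eq335RegularityClasses (Cplx337)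
open B9Eq369Small (Through)
open B9Eq372Locality (stBonds)
open B9Eq375Locality (locBondsA dirBondsA)
open LatticeNorms (scaleLen)
open B9Eq360DeltaPrimeAY (AfldY chartA chartA_apply)
open B9PinMembersKLevelV1 (MemberY geo9Y bg9Y)
open B9SectBGpLettersY (GVal coordC expAC blkC norm_le_one_and_inv_of_mem letters_base_of_gVal)
open B9SectBGpFrameCodedY (codingYx CplxLettersY)
open B9SectBCodedClassY (C37Y covD_chart norm_R_le_of_unitaryLike len_blkC_eq_scaleLen cplxLettersY_of_cplx337)
open B9Eq359VarParBY (cVarGY cVarGY_nonneg varParBY_mono varParBY_parBY_of_cplx337)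
open B9SectBGClassLettersY (CplxLettersGY VarParBY stencilF_blkC' stencilB_blkC' stencilFB_blkC stencilSt_blkC stencilThrough_blkC stencil0_blkC shiftY_shiftY_symm_comm)
open B9RWSumsCompleteGeo9YNbr (len_le_of_dist_lt_M_geo9K)
open B9GeoLemma21KLevelV1 (geo9Y_len_pos geo9K_eta_pos)
open B9GeoNormsKLevelV1 (geo9K)
open Node00 (SiteY BlkY IBondY CfgY UboxY shiftY parSymY parBY)

variable {𝔸 : Type} [NormedRing 𝔸] [NormedAlgebra ℂ 𝔸] [CompleteSpace 𝔸]
variable {d ℓ : ℕ} {hd : 1 ≤ d + 1} {hL : Odd (ℓ + 1) ∧ 1 < ℓ + 1} {b₀ b₁ : ℝ}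

/-! ## §1 Relocation by one stencil step -/

section Relocation

variable (i : KIdx d ℓ hd hL b₀ b₁) (ιB : BlkY i → IBondY i)

omit [NormedRing 𝔸] [NormedAlgebra ℂ 𝔸] [CompleteSpace 𝔸] in
/-- ★ **ONE STENCIL STEP COSTS A FACTOR `L`**: if the block of `w` is within block-graph distance `2(d+1) < M` of the block of `z`, then
`ℓ(Δ(w))⁻¹ ≦ L·ℓ(Δ(z))⁻¹` and `ℓ(Δ(w))⁻² ≦ L²·ℓ(Δ(z))⁻²` (neighbouring blocks differ by at most one level).
[cite: Balaban1984PropagatorsII, (2.2) p.224, Lemma 2.1 (2.60) p.234; Balaban1985BackgroundPropagators, p.397 (after (3.41))] -/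
theorem inv_len_blkC_le_of_dist (hdM : 2 * ((d : ℝ) + 1) < (geo9K i).M) {z w : SiteY i}
    (h : (geo9K i).dist (blkC i ιB z) (blkC i ιB w) ≤ 2 * ((d : ℝ) + 1)) :
    ((geo9K i).len (blkC i ιB w))⁻¹ ≤ (((ℓ + 1 : ℕ) : ℝ)) * ((geo9K i).len (blkC i ιB z))⁻¹ ∧
      ((geo9K i).len (blkC i ιB w) ^ 2)⁻¹ ≤ (((ℓ + 1 : ℕ) : ℝ)) ^ 2 * ((geo9K i).len (blkC i ιB z) ^ 2)⁻¹ := by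
  have h1 : (geo9K i).len (blkC i ιB z) ≤ (((ℓ + 1 : ℕ) : ℝ)) * (geo9K i).len (blkC i ιB w) := len_le_of_dist_lt_M_geo9K i (lt_of_le_of_lt h hdM)
  have hp : 0 < (geo9K i).len (blkC i ιB w) := B6KLevelCensusIndexV1.len_pos i _
  have hq : 0 < (geo9K i).len (blkC i ιB z) := B6KLevelCensusIndexV1.len_pos i _
  have hL0 : (0 : ℝ) < (((ℓ + 1 : ℕ) : ℝ)) := by positivity
  have e1 : ((geo9K i).len (blkC i ιB w))⁻¹ ≤ (((ℓ + 1 : ℕ) : ℝ)) * ((geo9K i).len (blkC i ιB z))⁻¹ := by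
    rw [inv_le_comm₀ hp (by positivity), mul_inv, inv_inv]
    calc ((((ℓ + 1 : ℕ) : ℝ)))⁻¹ * (geo9K i).len (blkC i ιB z) ≤ ((((ℓ + 1 : ℕ) : ℝ)))⁻¹ * ((((ℓ + 1 : ℕ) : ℝ)) * (geo9K i).len (blkC i ιB w)) :=
          mul_le_mul_of_nonneg_left h1 (by positivity)
      _ = _ := by field_simp
  refine ⟨e1, ?_⟩
  have e2 := mul_le_mul e1 e1 (by positivity) (by positivity)
  calc ((geo9K i).len (blkC i ιB w) ^ 2)⁻¹ = ((geo9K i).len (blkC i ιB w))⁻¹ * ((geo9K i).len (blkC i ιB w))⁻¹ := by rw [sq, mul_inv]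
    _ ≤ ((((ℓ + 1 : ℕ) : ℝ)) * ((geo9K i).len (blkC i ιB z))⁻¹) * ((((ℓ + 1 : ℕ) : ℝ)) * ((geo9K i).len (blkC i ιB z))⁻¹) := e2
    _ = (((ℓ + 1 : ℕ) : ℝ)) ^ 2 * ((geo9K i).len (blkC i ιB z) ^ 2)⁻¹ := by rw [sq, sq, mul_inv]; ring

omit [NormedRing 𝔸] [NormedAlgebra ℂ 𝔸] [CompleteSpace 𝔸] in
/-- every bond of the dependence set `locBondsA` of the bracket at `b = ⟨x, x+e_μ⟩` starts within `2(d+1)` of the block of `x` (sites `x`, `x − e_ν`,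
`x + e_μ − e_ν`; the `locBondsA` twin of gen 13's `stencilLoc_blkC`). [cite: Balaban1985BackgroundPropagators, (3.75) p.405; Balaban1984PropagatorsII, (2.46) p.231] -/
theorem stencilLocA_blkC (hι : ∀ s : BlkY i, β i.hN i.D i.hk (ιB s) = s) (μ : Fin (d + 1)) (x : SiteY i) (q : Fin (d + 1) × SiteY i)
    (hq : q ∈ locBondsA (shiftY i) μ x) : (geo9K i).dist (blkC i ιB x) (blkC i ιB q.2) ≤ 2 * ((d : ℝ) + 1) := by
  simp only [locBondsA, dirBondsA, Set.mem_iUnion, Set.mem_insert_iff, Set.mem_singleton_iff] at hq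
  obtain ⟨ν, rfl | rfl | rfl⟩ := hq
  · exact stencil0_blkC i ιB x
  · exact stencilB_blkC' i ιB hι ν x
  · exact stencilFB_blkC i ιB hι μ ν x

end Relocation

/-! ## §2 ★★ The seven further (3.37) letter bounds of the G clause from the record's class -/

section Letters

variable [NormOneClass 𝔸] {Mstar : ℕ} (G : Subgroup 𝔸ˣ) (x : MemberY d ℓ hd hL b₀ b₁ Mstar) (ιB : BlkY x.toKIdx → IBondY x.toKIdx)

omit [NormOneClass 𝔸] in
/-- ★★ **THE G-CLAUSE LETTERS FROM (3.37)**: at a `G`-valued `U` (unit-norm `G`), for `a` in r06's class `Cplx337` on the member's torus chart at exponent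
`0 ≦ α₁`, above `2(d+1) < M`, the seven bounds of `CplxLettersGY G x ιB (L⁴α₁) U a` hold: (1) `η⁻¹∇*_ν A′_ν` at `x + e_μ` (two stencil steps of `L²`:
`∇* = −R⁻¹∇` one step back, then the forward relocation); (2) `η⁻¹∇_μ A′_k` at `x − e_ν`; (3) the forward transport `τ_μ A′_k` at `x`; (4) `A′_k` at
`x + e_μ − e_ν`; (5)–(6) `A′` on `st(b)` and on `locBondsA`; (7) the unscaled `∇A′` at the plaquettes through `b`.  Every bound is the own-level (3.37) at the
stencil point, relocated to the block of the base point at one factor `L` per step.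
[cite: Balaban1985BackgroundPropagators, (3.37) p.396, p.397 (after (3.41)), (3.72)–(3.75) p.405; Balaban1984PropagatorsII, (2.46) p.231] -/
theorem cplxLettersGY_of_cplx337 (hι : ∀ s : BlkY x.toKIdx, β x.toKIdx.hN x.toKIdx.D x.toKIdx.hk (ιB s) = s)
    (hG1 : ∀ u : 𝔸ˣ, u ∈ G → ‖(u : 𝔸)‖ ≤ 1) (hdM : 2 * ((d : ℝ) + 1) < (geo9Y x).M)
    {U : CfgY 𝔸 x.toKIdx} (hU : GVal G x.toKIdx U) {α₁ : ℝ} (hα₁ : 0 ≤ α₁) {a : AfldY 𝔸 x.toKIdx}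
    (h : Cplx337 (shiftsV1 (PV d ℓ x.m x.K hd hL)) U (kGeo x.toKIdx).eta (kGeo x.toKIdx).L (levV1 x.toKIdx) α₁ a) :
    CplxLettersGY G x ιB ((((ℓ : ℝ) + 1) ^ 4) * α₁) U a := by
  set η : ℝ := (kGeo x.toKIdx).eta with hη
  set Lr : ℝ := ((ℓ : ℝ) + 1) with hLr
  have hη0 : 0 < η := geo9K_eta_pos x.toKIdx
  have hL1 : (1 : ℝ) ≤ Lr := by rw [hLr]; have : (0 : ℝ) ≤ ℓ := Nat.cast_nonneg _; linarith
  have hLn : (((ℓ + 1 : ℕ) : ℝ)) = Lr := by rw [hLr]; push_cast; ring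
  have hL2 : Lr ≤ Lr ^ 4 := by
    calc Lr = Lr ^ 1 := (pow_one _).symm
      _ ≤ Lr ^ 4 := pow_le_pow_right₀ hL1 (by norm_num)
  have hL24 : Lr ^ 2 ≤ Lr ^ 4 := pow_le_pow_right₀ hL1 (by norm_num)
  have hUu : ∀ μ v, UnitaryLike (U μ v) := fun μ v => norm_le_one_and_inv_of_mem G hG1 (hU μ v)
  have hco : coordC G x.toKIdx (.base U) = UboxY x.toKIdx U := (letters_base_of_gVal G x.toKIdx (parSymY x.toKIdx) hU).1
  have hexp : expAC x.toKIdx (.base U) (.mult a) = chartA x.toKIdx a := rfl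
  have hlen0 : ∀ z : SiteY x.toKIdx, 0 < (geo9Y x).len (blkC x.toKIdx ιB z) := fun z => geo9Y_len_pos x _
  -- the class bounds at a torus point and its own level, in terms of the frame's block length
  obtain ⟨hA, hDA⟩ := h
  have hscale : ∀ z : SiteY x.toKIdx, scaleLen (kGeo x.toKIdx).L (kGeo x.toKIdx).eta (levV1 x.toKIdx ((boxEquiv x.toKIdx.hN).symm z)) = (geo9Y x).len (blkC x.toKIdx ιB z) :=
    fun z => (len_blkC_eq_scaleLen x.toKIdx ιB hι z).symm
  have hA' : ∀ (κ : Fin (d + 1)) (z : SiteY x.toKIdx), ‖a κ ((boxEquiv x.toKIdx.hN).symm z)‖ ≤ α₁ * ((geo9Y x).len (blkC x.toKIdx ιB z))⁻¹ := fun κ z => by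
    have := hA _ κ ((boxEquiv x.toKIdx.hN).symm z) le_rfl
    rw [hscale] at this; exact this.le
  have hDA' : ∀ (μ ν : Fin (d + 1)) (z : SiteY x.toKIdx),
      ‖((η : ℂ)⁻¹) • covD (shiftY x.toKIdx) (UboxY x.toKIdx U) μ (chartA x.toKIdx a ν) z‖ ≤ α₁ * ((geo9Y x).len (blkC x.toKIdx ιB z) ^ 2)⁻¹ := fun μ ν z => by
    have := hDA _ μ ν ((boxEquiv x.toKIdx.hN).symm z) le_rfl
    rw [hscale, ← covD_chart x.toKIdx U μ (a ν)] at this; exact this.le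
  -- relocation by one stencil step
  have reloc : ∀ {z w : SiteY x.toKIdx}, (geo9Y x).dist (blkC x.toKIdx ιB z) (blkC x.toKIdx ιB w) ≤ 2 * ((d : ℝ) + 1) →
      ((geo9Y x).len (blkC x.toKIdx ιB w))⁻¹ ≤ Lr * ((geo9Y x).len (blkC x.toKIdx ιB z))⁻¹ ∧
        ((geo9Y x).len (blkC x.toKIdx ιB w) ^ 2)⁻¹ ≤ Lr ^ 2 * ((geo9Y x).len (blkC x.toKIdx ιB z) ^ 2)⁻¹ := by
    intro z w hzw
    have h := inv_len_blkC_le_of_dist x.toKIdx ιB hdM hzw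
    rw [hLn] at h
    exact h
  -- `η⁻¹∇*_ν A′_k (w) = −R(…)⁻¹ η⁻¹∇_ν A′_k (w − e_ν)`: the bound `L²α₁ℓ(Δ(w))⁻²` at every point
  have h3 : ∀ (ν k : Fin (d + 1)) (w : SiteY x.toKIdx),
      ‖((η : ℂ)⁻¹) • covDstar (shiftY x.toKIdx) (UboxY x.toKIdx U) ν (chartA x.toKIdx a k) w‖ ≤ Lr ^ 2 * α₁ * ((geo9Y x).len (blkC x.toKIdx ιB w) ^ 2)⁻¹ := by
    intro ν k w
    rw [covDstar_eq_neg_R_covD _ _ ν _ w, smul_neg, norm_neg, ← R_smul]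
    refine ((norm_R_le_of_unitaryLike (hUu ν _) _).2).trans ?_
    refine (hDA' ν k ((shiftY x.toKIdx ν).symm w)).trans ?_
    have := (reloc (stencilB_blkC' x.toKIdx ιB hι ν w)).2
    calc α₁ * ((geo9Y x).len (blkC x.toKIdx ιB ((shiftY x.toKIdx ν).symm w)) ^ 2)⁻¹ ≤ α₁ * (Lr ^ 2 * ((geo9Y x).len (blkC x.toKIdx ιB w) ^ 2)⁻¹) :=
          mul_le_mul_of_nonneg_left this hα₁
      _ = Lr ^ 2 * α₁ * ((geo9Y x).len (blkC x.toKIdx ιB w) ^ 2)⁻¹ := by ring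
  refine ⟨?_, ?_, ?_, ?_, ?_, ?_, ?_⟩
  · -- (1) `η⁻¹∇*_ν A′_ν` at `x + e_μ`
    intro μ ν z
    rw [hco, hexp]
    refine (h3 ν ν (shiftY x.toKIdx μ z)).trans ?_
    have := (reloc (stencilF_blkC' x.toKIdx ιB hι μ z)).2
    have hw : 0 ≤ α₁ * ((geo9Y x).len (blkC x.toKIdx ιB z) ^ 2)⁻¹ := by positivity
    calc Lr ^ 2 * α₁ * ((geo9Y x).len (blkC x.toKIdx ιB (shiftY x.toKIdx μ z)) ^ 2)⁻¹
        ≤ Lr ^ 2 * α₁ * (Lr ^ 2 * ((geo9Y x).len (blkC x.toKIdx ιB z) ^ 2)⁻¹) := mul_le_mul_of_nonneg_left this (by positivity)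
      _ = Lr ^ 4 * α₁ * ((geo9Y x).len (blkC x.toKIdx ιB z) ^ 2)⁻¹ := by ring
  · -- (2) `η⁻¹∇_μ A′_k` at `x − e_ν`
    intro μ ν k z
    rw [hco, hexp]
    refine (hDA' μ k ((shiftY x.toKIdx ν).symm z)).trans ?_
    have := (reloc (stencilB_blkC' x.toKIdx ιB hι ν z)).2
    have hw : 0 ≤ α₁ * ((geo9Y x).len (blkC x.toKIdx ιB z) ^ 2)⁻¹ := by positivity
    calc α₁ * ((geo9Y x).len (blkC x.toKIdx ιB ((shiftY x.toKIdx ν).symm z)) ^ 2)⁻¹ ≤ α₁ * (Lr ^ 2 * ((geo9Y x).len (blkC x.toKIdx ιB z) ^ 2)⁻¹) :=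
          mul_le_mul_of_nonneg_left this hα₁
      _ = Lr ^ 2 * (α₁ * ((geo9Y x).len (blkC x.toKIdx ιB z) ^ 2)⁻¹) := by ring
      _ ≤ Lr ^ 4 * (α₁ * ((geo9Y x).len (blkC x.toKIdx ιB z) ^ 2)⁻¹) := mul_le_mul_of_nonneg_right hL24 hw
      _ = _ := by ring
  · -- (3) the forward transport `τ_μ A′_k (x) = R(U_μ(x)) A′_k(x + e_μ)`
    intro μ k z
    rw [hco, hexp]
    have ht : tauF (shiftY x.toKIdx) (UboxY x.toKIdx U) μ (chartA x.toKIdx a k) z = R (UboxY x.toKIdx U μ z) (chartA x.toKIdx a k (shiftY x.toKIdx μ z)) := rfl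
    rw [ht]
    refine ((norm_R_le_of_unitaryLike (hUu μ _) _).1).trans ?_
    rw [chartA_apply]
    refine (hA' k (shiftY x.toKIdx μ z)).trans ?_
    have := (reloc (stencilF_blkC' x.toKIdx ιB hι μ z)).1
    have hw : 0 ≤ α₁ * ((geo9Y x).len (blkC x.toKIdx ιB z))⁻¹ := mul_nonneg hα₁ (inv_nonneg.2 (hlen0 z).le)
    calc α₁ * ((geo9Y x).len (blkC x.toKIdx ιB (shiftY x.toKIdx μ z)))⁻¹ ≤ α₁ * (Lr * ((geo9Y x).len (blkC x.toKIdx ιB z))⁻¹) :=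
          mul_le_mul_of_nonneg_left this hα₁
      _ = Lr * (α₁ * ((geo9Y x).len (blkC x.toKIdx ιB z))⁻¹) := by ring
      _ ≤ Lr ^ 4 * (α₁ * ((geo9Y x).len (blkC x.toKIdx ιB z))⁻¹) := mul_le_mul_of_nonneg_right hL2 hw
      _ = _ := by ring
  · -- (4) `A′_k` at `x + e_μ − e_ν`
    intro k μ ν z
    rw [hexp, chartA_apply]
    refine (hA' k ((shiftY x.toKIdx ν).symm (shiftY x.toKIdx μ z))).trans ?_
    have := (reloc (stencilFB_blkC x.toKIdx ιB hι μ ν z)).1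
    have hw : 0 ≤ α₁ * ((geo9Y x).len (blkC x.toKIdx ιB z))⁻¹ := mul_nonneg hα₁ (inv_nonneg.2 (hlen0 z).le)
    calc α₁ * ((geo9Y x).len (blkC x.toKIdx ιB ((shiftY x.toKIdx ν).symm (shiftY x.toKIdx μ z))))⁻¹
        ≤ α₁ * (Lr * ((geo9Y x).len (blkC x.toKIdx ιB z))⁻¹) := mul_le_mul_of_nonneg_left this hα₁
      _ = Lr * (α₁ * ((geo9Y x).len (blkC x.toKIdx ιB z))⁻¹) := by ring
      _ ≤ Lr ^ 4 * (α₁ * ((geo9Y x).len (blkC x.toKIdx ιB z))⁻¹) := mul_le_mul_of_nonneg_right hL2 hw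
      _ = _ := by ring
  · -- (5) `A′` on `st(b)`
    intro μ z m w hq
    rw [hexp, chartA_apply]
    refine (hA' m w).trans ?_
    have := (reloc (stencilSt_blkC x.toKIdx ιB hι μ z (m, w) hq)).1
    have hw : 0 ≤ α₁ * ((geo9Y x).len (blkC x.toKIdx ιB z))⁻¹ := mul_nonneg hα₁ (inv_nonneg.2 (hlen0 z).le)
    calc α₁ * ((geo9Y x).len (blkC x.toKIdx ιB w))⁻¹ ≤ α₁ * (Lr * ((geo9Y x).len (blkC x.toKIdx ιB z))⁻¹) := mul_le_mul_of_nonneg_left this hα₁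
      _ = Lr * (α₁ * ((geo9Y x).len (blkC x.toKIdx ιB z))⁻¹) := by ring
      _ ≤ Lr ^ 4 * (α₁ * ((geo9Y x).len (blkC x.toKIdx ιB z))⁻¹) := mul_le_mul_of_nonneg_right hL2 hw
      _ = _ := by ring
  · -- (6) `A′` on `locBondsA`
    intro μ z m w hq
    rw [hexp, chartA_apply]
    refine (hA' m w).trans ?_
    have := (reloc (stencilLocA_blkC x.toKIdx ιB hι μ z (m, w) hq)).1
    have hw : 0 ≤ α₁ * ((geo9Y x).len (blkC x.toKIdx ιB z))⁻¹ := mul_nonneg hα₁ (inv_nonneg.2 (hlen0 z).le)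
    calc α₁ * ((geo9Y x).len (blkC x.toKIdx ιB w))⁻¹ ≤ α₁ * (Lr * ((geo9Y x).len (blkC x.toKIdx ιB z))⁻¹) := mul_le_mul_of_nonneg_left this hα₁
      _ = Lr * (α₁ * ((geo9Y x).len (blkC x.toKIdx ιB z))⁻¹) := by ring
      _ ≤ Lr ^ 4 * (α₁ * ((geo9Y x).len (blkC x.toKIdx ιB z))⁻¹) := mul_le_mul_of_nonneg_right hL2 hw
      _ = _ := by ring
  · -- (7) the unscaled `∇A′` at the plaquettes through `b`: `‖∇_m A′_n (y)‖ = η·‖η⁻¹∇_m A′_n (y)‖`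
    intro μ z m n y hthr
    rw [hco, hexp]
    have hd := reloc (stencilThrough_blkC x.toKIdx ιB hι hthr)
    have unscale : ∀ (m n : Fin (d + 1)), ‖covD (shiftY x.toKIdx) (UboxY x.toKIdx U) m (chartA x.toKIdx a n) y‖ ≤
        η * (Lr ^ 4 * α₁ * (((geo9Y x).len (blkC x.toKIdx ιB z))⁻¹) ^ 2) := by
      intro m n
      have hs := hDA' m n y
      have hn : ‖((η : ℂ)⁻¹) • covD (shiftY x.toKIdx) (UboxY x.toKIdx U) m (chartA x.toKIdx a n) y‖ =
          η⁻¹ * ‖covD (shiftY x.toKIdx) (UboxY x.toKIdx U) m (chartA x.toKIdx a n) y‖ := by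
        rw [norm_smul, norm_inv, Complex.norm_real, Real.norm_eq_abs, abs_of_pos hη0]
      rw [hn] at hs
      have hs' : ‖covD (shiftY x.toKIdx) (UboxY x.toKIdx U) m (chartA x.toKIdx a n) y‖ ≤ η * (α₁ * ((geo9Y x).len (blkC x.toKIdx ιB y) ^ 2)⁻¹) := by
        rw [← inv_mul_le_iff₀ hη0]; exact hs
      refine hs'.trans (mul_le_mul_of_nonneg_left ?_ hη0.le)
      have hw : 0 ≤ α₁ * ((geo9Y x).len (blkC x.toKIdx ιB z) ^ 2)⁻¹ := by positivity
      rw [inv_pow]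
      calc α₁ * ((geo9Y x).len (blkC x.toKIdx ιB y) ^ 2)⁻¹ ≤ α₁ * (Lr ^ 2 * ((geo9Y x).len (blkC x.toKIdx ιB z) ^ 2)⁻¹) := mul_le_mul_of_nonneg_left hd.2 hα₁
        _ = Lr ^ 2 * (α₁ * ((geo9Y x).len (blkC x.toKIdx ιB z) ^ 2)⁻¹) := by ring
        _ ≤ Lr ^ 4 * (α₁ * ((geo9Y x).len (blkC x.toKIdx ιB z) ^ 2)⁻¹) := mul_le_mul_of_nonneg_right hL24 hw
        _ = _ := by ring
    exact ⟨unscale m n, unscale n m⟩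

end Letters

/-! ## §3 The extended coded class `C37GY`, its dictionaries `hC37` ∕ `hC37G`, and the chain's class hypothesis -/

section Class

variable [NormOneClass 𝔸] {Mstar : ℕ} (G : Subgroup 𝔸ˣ) (x : MemberY d ℓ hd hL b₀ b₁ Mstar) (ιB : BlkY x.toKIdx → IBondY x.toKIdx)

/-- **THE EXTENDED CODED CLASS (3.37) OF THE SECT.-B CHAIN AT NODE 00, G SIDE**: a pair (base `U`, field `a`) is in the class at exponent `β` iff it is in g8's
coded class `C37Y` (`U` `G`-valued, the seven root letters at `β`, transporter `parSymY`, constant `Cq`), the seven further letter bounds `CplxLettersGY` of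
r06's G clause hold at `β`, AND the bond-averaging transporter variation `VarParBY` holds at `β` for the taxicab table `parBY` with `c_var = cVarGY d ℓ`.
[cite: Balaban1985BackgroundPropagators, (3.37) p.396, (3.58)–(3.59) p.402, (3.72)–(3.75) p.405, (3.80)–(3.81) p.406] -/
def C37GY (Cq : ℝ) : ℝ → CfgY 𝔸 x.toKIdx → AfldY 𝔸 x.toKIdx → Prop :=
  fun β U a => C37Y G x ιB Cq β U a ∧ CplxLettersGY G x ιB β U a ∧ VarParBY x.toKIdx (parBY x.toKIdx) (cVarGY d ℓ) β U a

omit [NormOneClass 𝔸] in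
/-- ★ **THE ROOT DICTIONARY `hC37` OF THE FRAMES HOLDS BY PROJECTION** for `C37 := C37GY` (the binder `hC37` of `gpFrame₂CodedOn` ∕ `cinvFrame₃CodedOn` ∕
`gFrame₅CodedOn`). [cite: Balaban1985BackgroundPropagators, (3.37) p.396, bookkeeping] -/
theorem hC37_of_C37GY (Cq : ℝ) :
    ∀ β (U : CfgY 𝔸 x.toKIdx) (a : AfldY 𝔸 x.toKIdx), C37GY G x ιB Cq β U a → GVal G x.toKIdx U ∧ CplxLettersY G x (parSymY x.toKIdx) ιB Cq β U a :=
  fun _ _ _ h => h.1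

omit [NormOneClass 𝔸] in
/-- ★ **THE G-SIDE DICTIONARY `hC37G` OF `gFrame₅CodedOn` HOLDS BY PROJECTION** for `C37 := C37GY`. [cite: Balaban1985BackgroundPropagators, (3.37) p.396, (3.72)–(3.75) p.405, bookkeeping] -/
theorem hC37G_of_C37GY (Cq : ℝ) :
    ∀ β (U : CfgY 𝔸 x.toKIdx) (a : AfldY 𝔸 x.toKIdx), C37GY G x ιB Cq β U a → CplxLettersGY G x ιB β U a :=
  fun _ _ _ h => h.2.1

omit [NormOneClass 𝔸] in
/-- ★ **THE G-SIDE LAW `hvarB` OF `gFrame₅CodedOn` HOLDS BY PROJECTION** for `C37 := C37GY`, `parB := parBY`, `cVar := cVarGY d ℓ`.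
[cite: Balaban1985BackgroundPropagators, (3.80)–(3.81) p.406, bookkeeping] -/
theorem hvarB_of_C37GY (Cq : ℝ) :
    ∀ β (U : CfgY 𝔸 x.toKIdx) (a : AfldY 𝔸 x.toKIdx), C37GY G x ιB Cq β U a → VarParBY x.toKIdx (parBY x.toKIdx) (cVarGY d ℓ) β U a :=
  fun _ _ _ h => h.2.2

omit [NormOneClass 𝔸] in
/-- the extended class implies «`U` is `G`-valued». [cite: Balaban1985BackgroundPropagators, (3.35) p.396, bookkeeping] -/
theorem gVal_of_C37GY {Cq β : ℝ} {U : CfgY 𝔸 x.toKIdx} {a : AfldY 𝔸 x.toKIdx} (h : C37GY G x ιB Cq β U a) : GVal G x.toKIdx U := h.1.1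

/-- ★★ **`hclass` AT ONE MEMBER FOR THE EXTENDED CLASS**: above `2(d+1) < M`, every `U′` of the record's class (3.37) at a (3.35)-regular `U` and exponent
`0 < α₁ ≦ 1∕4` has the code `a := A′` (`U′ = e^{iηA′}`) in `C37GY` at exponent `L⁴α₁` (g8's `hclass_C37Y_at`, §2, and `varParBY_parBY_of_cplx337` raised
from `α₁` to `L⁴α₁`). [cite: Balaban1985BackgroundPropagators, (3.37) p.396, (3.35) p.396, Thm 3.4 p.400] -/
theorem hclass_C37GY_at (hι : ∀ s : BlkY x.toKIdx, β x.toKIdx.hN x.toKIdx.D x.toKIdx.hk (ιB s) = s)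
    (hG1 : ∀ u : 𝔸ˣ, u ∈ G → ‖(u : 𝔸)‖ ≤ 1) (hdM : 2 * ((d : ℝ) + 1) < (geo9Y x).M) {c35 α₀ α₁ : ℝ} {U U' : (bg9Y 𝔸 G x).Cfg}
    (hreg : (bg9Y 𝔸 G x).Reg335 c35 α₀ U) (hα₁ : 0 < α₁) (hα₁4 : α₁ ≤ 1 / 4) (h37 : (bg9Y 𝔸 G x).Cplx337 α₁ U U') :
    ∃ a : AfldY 𝔸 x.toKIdx, fluct (kGeo x.toKIdx).eta a = U' ∧
      C37GY G x ιB (4 * ((d : ℝ) + 1) * Real.exp (3 * (((d : ℝ) + 1) / 2))) ((((ℓ : ℝ) + 1) ^ 4) * α₁) U a := by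
  obtain ⟨A', hU', hcl⟩ := h37
  have hL4 : (1 : ℝ) ≤ ((ℓ : ℝ) + 1) ^ 4 := one_le_pow₀ (by have : (0 : ℝ) ≤ ℓ := Nat.cast_nonneg _; linarith)
  have hmono : α₁ ≤ (((ℓ : ℝ) + 1) ^ 4) * α₁ := le_mul_of_one_le_left hα₁.le hL4
  exact ⟨A', hU'.symm, ⟨hreg.1.1, cplxLettersY_of_cplx337 G x ιB hι hG1 hdM hreg.1.1 hα₁ hα₁4 hcl⟩,
    cplxLettersGY_of_cplx337 G x ιB hι hG1 hdM hreg.1.1 hα₁.le hcl,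
    varParBY_mono x.toKIdx (parBY x.toKIdx) (cVarGY_nonneg d ℓ) hmono
      (varParBY_parBY_of_cplx337 G x hG1 hreg.1.1 hα₁.le hα₁4 hcl)⟩

end Class

/-! ## §4 `hclass` for the extended class on a subfamily -/

section Family

variable [NormOneClass 𝔸] {Mstar : ℕ} {J : Type} (f : J → MemberY d ℓ hd hL b₀ b₁ Mstar) (G : Subgroup 𝔸ˣ)
  (ιB : ∀ j : J, BlkY (f j).toKIdx → IBondY (f j).toKIdx) (C38 : ∀ j : J, ℝ → CfgY 𝔸 (f j).toKIdx → AfldY 𝔸 (f j).toKIdx → Prop)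

/-- ★ **`hclass` OF `sectBStepPrinted_of_coded` ON A SUBFAMILY, for the codings `codingYx G (f j) (C37GY …) (C38 j)`**: `r := L⁴`, `αcap := 1∕4`,
`Mc := 2(d+1)+1`, any `ac` — `hclass_C37GY_at` at the members `f j` (the `C37GY` twin of `B9SectBCodedChainC37Y.hclass_C37Y_on`).
[cite: Balaban1985BackgroundPropagators, (3.37) p.396, (3.58) p.402, Thm 3.4 p.400] -/
theorem hclass_C37GY_on (hι : ∀ (j : J) (s : BlkY (f j).toKIdx), β (f j).toKIdx.hN (f j).toKIdx.D (f j).toKIdx.hk (ιB j s) = s)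
    (hG1 : ∀ u : 𝔸ˣ, u ∈ G → ‖(u : 𝔸)‖ ≤ 1) (c35 ac : ℝ) :
    ∀ (j : J) (α₀ α₁ : ℝ) (U U' : (bg9Y 𝔸 G (f j)).Cfg), 2 * ((d : ℝ) + 1) + 1 ≤ (geo9Y (f j)).M → 0 < α₀ → (geo9Y (f j)).M * α₀ ≤ ac →
      (bg9Y 𝔸 G (f j)).Reg335 c35 α₀ U → 0 < α₁ → α₁ ≤ 1 / 4 → (bg9Y 𝔸 G (f j)).Cplx337 α₁ U U' →
      ∃ a : (codingYx G (f j) (C37GY G (f j) (ιB j) (4 * ((d : ℝ) + 1) * Real.exp (3 * (((d : ℝ) + 1) / 2)))) (C38 j)).A,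
        (codingYx G (f j) (C37GY G (f j) (ιB j) (4 * ((d : ℝ) + 1) * Real.exp (3 * (((d : ℝ) + 1) / 2)))) (C38 j)).decA a = U' ∧
        (codingYx G (f j) (C37GY G (f j) (ιB j) (4 * ((d : ℝ) + 1) * Real.exp (3 * (((d : ℝ) + 1) / 2)))) (C38 j)).C37 ((((ℓ : ℝ) + 1) ^ 4) * α₁) U a := by
  intro j α₀ α₁ U U' hM _ _ hreg hα₁ hα₁4 h37
  exact hclass_C37GY_at G (f j) (ιB j) (hι j) hG1 (by linarith) hreg hα₁ hα₁4 h37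

end Family

end Literature.MathematicalPhysics.QuantumFieldTheory.Balaban1983to89.B9SectBCodedClassGY

end
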